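import Summits.QuantumFields.YangMills.Theorems.BalabanUVNodesN08SlotOfRecordFromAlphaACMassBound

/-!
# BalabanUVNodes ∕ N08 — WHAT THE a.e. MASS BOUND BUYS: the large-field row B25 of [Balaban1985UV3] (pp. 273–274) for an AC tower holds
# `dU_k`-ALMOST EVERYWHERE under a `dU_k`-a.e. extensive bound on the history masses — file 15's chain run on the capped masses `min 1 (e^{−c}·m)`

Track A, DAG node N08 = T. Bałaban, CMP **102** (1985) 255–275 [Balaban1985UV3]: Thm 1 p. 257 (bounds (5)), (41) p. 266, (67)–(71) pp. 273–274; print's averaging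
(2) = [Balaban1985Averaging] (15) p. 19.  Cell `pub-ymgap`, width seat `pub-ymgap-dag-n08-w1` (g4), W-SEAT-START-LIST §n08 item 1 successor piece (o12) = file 18;
`--supports` K1⁷ `StabilityBAtRecordR13SepCoPH` (helper).  Companion of file 15 `…N08SlotOfRecordFromAlphaACMassBound` ((R4⁗), POINTWISE `hmass`) and of files
16∕17 (the a.e. reduction of the mass bound to a density bound on the least weakly-closed family `ν♯`).

THE POINT (located, count-neutral).  Files 16∕17 deliver the mass bound only `dU_k`-ALMOST EVERYWHERE (analysis bounds Radon–Nikodym VERSIONS a.e.); file 15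
consumes it POINTWISE (the row B25 = `AnalyticLeaves.lf` is a `∀ U` statement about the tower's functional `LF_k(U)[·] = Σ_h m_k(h,U)·e^{(·)}`).  This file
records exactly what the a.e. bound buys WITHOUT any re-selection: **B25 for `dU_k`-a.e. `U`**, at the same re-booked constant `d + c_m` — by running the
lane's UNCHANGED Theorem-1 chain `LiftBridge.lf_tower3_avg` on the std input with the CAPPED masses `min 1 (e^{−c_k}·m_k)` (pointwise `≤ 1`, so the chain
applies verbatim) and undoing the scaling on the full-measure set `{U | ∀ h, m_k(h,U) ≤ e^{c_k}}` (a FINITE intersection over histories), where the cap is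
inactive.  The complement — the `dU_k`-null set `N_k = {U | ∃ h, m_k(h,U) > e^{c_k}}` — is precisely what part (b) of `N08-E6PRIME-LOAD-POINT.md` (version
re-selection of the masses ∕ barriers) has to absorb for the POINTWISE row; nothing here touches it.

WHAT THIS FILE PROVES (kernel; theorems only, 0 def; nothing of the paper asserted).
* §1 ★★ `lf_towerAC3_ae_of_massBound_ae` — for `D : TowerAC.TowerInputAC S G` with `m_k(h,·) ≤ e^{c_m|T₁^{(k)}|}` `dU_k`-a.e. for `1 ≤ k ≤ K` (every
  history) and vanishing off admissible histories, and the hypotheses of `LiftBridge.lf_tower3_avg` verbatim (as in file 15 §1):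
  `LF_k(U)[−(1/g_k²)A(U_k(h,U)) + Σ_j O(log g_j⁻¹)|Z_j|] ≤ e^{(d + c_m)|T₁^{(k)}|}` for `dU_k`-a.e. `U`, every `k ≤ K`.
* §2 ★★ `lf_towerOfAC_ae_of_alphaAC_of_massBound_ae` — the same AT THE LANE'S AC TOWER `towerOfAC 𝔠.lane X 𝔖` from `RunAlphaAC`'s rows `hLF67`∕`h68` + the a.e.
  mass bound (every lane-side hypothesis discharged as in file 15 §2).
* §3 ★★ `lf_towerOfAC_ae_at_print_of_alphaAC_of_massBound_ae` — A6 ∃X form at PRINT'S OWN averaging pinned to the record (file 9 §2's inhabitant): the a.e. bound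
  stated X-free on print's iterated Radon–Nikodym masses `MassesAC.massRecAC … (avOfPrint N S)` — the exact output currency of files 16∕17.

HONEST FRAMING: count-neutral helper; B25 is obtained ALMOST EVERYWHERE only, under the (α)-AC rows and an a.e. mass bound that are HYPOTHESES (N08's object gap
in AC currency); the pointwise row, `PrintedUV3V`, Thm 1–2 at the record are NOT proved; N08 NOT discharged; one finite 𝕋⁴ programme at fixed ε, Bałaban AS
PRINTED — R4 closes the conditional finite-𝕋⁴ rung `BalabanLadder.UV` only; the Yang–Mills mass gap (Clay) is NOT proved by any of this; nothing continuum ∕ ℝ⁴ ∕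
OS.  No `sorry`, standard axioms.
-/

noncomputable section

open MeasureTheory

namespace Summit.QuantumFields.YangMills.BalabanUVNodes.N08LargeFieldRowAE

open scoped Matrix.Norms.L2Operator
open Literature.MathematicalPhysics.QuantumFieldTheory.Balaban1983to89
open Literature.MathematicalPhysics.QuantumFieldTheory.Balaban1983to89.B10 (TowerRun pFun)
open Literature.MathematicalPhysics.QuantumFieldTheory.Balaban1983to89.Node00 (SU)
open Literature.MathematicalPhysics.QuantumFieldTheory.Balaban1983to89.B10RunsOfRecord
open Literature.MathematicalPhysics.QuantumFieldTheory.Balaban1985CMP102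
open Literature.MathematicalPhysics.QuantumFieldTheory.Balaban1985CMP102.Setting
open Literature.MathematicalPhysics.QuantumFieldTheory.Balaban1985CMP102.Theorems (Family)
open Summit.QuantumFields.Balaban3D
open Summit.QuantumFields.Balaban3D.Carriers (nblkOf StepSeries Hist HistWeights TowerInput rcolOf eps1Of epsSOf)
open Summit.QuantumFields.Balaban3D.Proofs
open Summit.QuantumFields.Balaban3D.Proofs.ScalesArithmetic
open Summit.QuantumFields.Balaban3D.Proofs.Constants (eps0Of consts3_d_eq_log)
open Summit.QuantumFields.Balaban3D.Proofs.FamilyLE (le_of_eps0Of thresholds_of_le)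
open Summit.QuantumFields.Balaban3D.Proofs.Family (prov_hb₁ prov_hb₂)
open Summit.QuantumFields.Balaban3D.Proofs.GroupModelLieC (lieC)
open Summit.QuantumFields.Balaban3D.Proofs.TowerAC (TowerInputAC LFAC)
open Summit.QuantumFields.Balaban3D.Proofs.StandardAC (ExternalInputsAC)
open Summit.QuantumFields.Balaban3D.Proofs.InputsAC (inputOfAC towerOfAC)
open Summit.QuantumFields.Balaban3D.Proofs.AlphaAC (AlphaDataAC RunAlphaAC)
open Summit.QuantumFields.Balaban3D.Proofs.Thresholds (gamma71L)
open Summit.QuantumFields.Balaban3D.Proofs.LiftBridge (liftCfg lf_tower3_avg)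
open Summit.QuantumFields.Balaban3D.Proofs.Run3SmallFactors (codeZ)
open Summit.QuantumFields.YangMills.BalabanUVNodes.N08Thm2AsPrintedAtSlotOfRecordAC (exists_externalInputsAC_ofPrint)
open B7Prop1Explicit (hol plaqWord)
open B7Prop1Local (pdevOn loK plaqHiK)
open B7Prop2Explicit (avgIter)
open B10LargeField (xlog)

/-! ## §1 Row B25 almost everywhere for an AC tower input under an a.e. extensive mass bound -/
section Generic

variable {L : ℕ} {S : Scales L} {G : Type} [GaugeGroup G] [MeasurableSpace G] [HaarData G]

/-- ★★ **`B10Assembly.LeafSystem.lf` (pp. 273–274) FOR AN AC TOWER INPUT, `dU_k`-ALMOST EVERYWHERE, UNDER A `dU_k`-a.e. EXTENSIVE MASS BOUND**: for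
`D : TowerAC.TowerInputAC S G` with `m_k(h,U) ≤ exp(c_m·|T₁^{(k)}|)` for `dU_k`-a.e. `U` (`1 ≤ k ≤ K`, every history) and vanishing off admissible histories, and
the hypotheses of `LiftBridge.lf_tower3_avg` verbatim (the (α) displays (67) ∘ large field and (68), the window, collar profile, Z-term coefficients, provisos NOT IN
PRINT), one gets for every `k ≤ K`: `LF_k(U)[−(1/g_k²)A(U_k(h,U)) + Σ_{j<k} zcoef_j|Z_j|(h)] ≤ exp((C.d + c_m)·|T₁^{(k)}|)` for `dU_k`-a.e. `U`.  MECHANISM: the std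
tower input with the CAPPED masses `min 1 (e^{−c_m|T₁^{(k)}|}·m_k)` (pointwise `≤ 1`; file 15 §1 used `e^{−c}·m` under the pointwise bound) runs through the lane's
chain unchanged; on the full-measure set `{U | ∀ h, m_k(h,U) ≤ e^{c_m|T₁^{(k)}|}}` (finitely many histories: `Filter.eventually_all`) the cap is inactive and the
scaling is undone as in file 15. [cite: Balaban1985UV3, pp.273–274 + (67)–(68) p.273 + (39)–(41) p.266] -/
theorem lf_towerAC3_ae_of_massBound_ae (𝔊 : GroupModel G) (C : B10Assembly.Consts) (hd : C.d = 6 / Real.log C.L) (hCL : C.L = (L : ℝ))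
    (hL : 2 ≤ L) (D : TowerInputAC S G) {ρ' r₀ A gs ε C₁ cm : ℝ}
    (hsites : ∀ k, k ≤ S.K → S.sites k = (Fintype.card (Site S.P k) : ℝ))
    (hW : ∀ (k : ℕ) (h : Hist S.P k) (U : GaugeField S.P k G), ¬ Hist.Admissible D.M₁ D.Rcol k h → D.W.mass k h U = 0)
    (hcm : 0 ≤ cm)
    (hmass : ∀ k, 1 ≤ k → k ≤ S.K → ∀ h : Hist S.P k, ∀ᵐ U ∂(fieldMeasure S.P k G), D.W.mass k h U ≤ Real.exp (cm * S.sites k))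
    (hε : 0 < ε) (hC₁ : 0 < C₁) (hb₀ : 0 < D.b₀) (hp₀ : 0 < D.p₀)
    (hrun : ∀ j, S.gk j = B10.gRun C.g C.L ε j)
    (hγ : ∀ j, j < S.K → S.gk j ≤ gamma71L C₁ L D.b₀ D.p₀)
    (hLF67 : ∀ k, k ≤ S.K → ∀ (h : Hist S.P k), Hist.Admissible D.M₁ D.Rcol k h → ∀ (U : GaugeField S.P k G),
      ∀ e ∈ Hist.disc h, S.gk e.1 * B10.pFun D.b₀ D.p₀ (S.gk e.1) ≤
        ‖((hol (avgIter L (liftCfg 𝔊 (D.UkH k h U)) e.1) (codeZ e) (plaqWord e.2.2.1 e.2.2.2) :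
            (Matrix (Fin 𝔊.N) (Fin 𝔊.N) ℂ)ˣ) : Matrix (Fin 𝔊.N) (Fin 𝔊.N) ℂ) - 1‖)
    (h68 : ∀ k, k ≤ S.K → ∀ (h : Hist S.P k), Hist.Admissible D.M₁ D.Rcol k h → ∀ (U : GaugeField S.P k G),
      ∀ e ∈ Hist.disc h,
        pdevOn (loK L e.1 (codeZ e)) (plaqHiK L e.1 (codeZ e) e.2.2.1 e.2.2.2) (liftCfg 𝔊 (D.UkH k h U)) <
          C₁ * (S.gk e.1 * B10.pFun D.b₀ D.p₀ (S.gk e.1)) * (((L : ℝ) ^ e.1)⁻¹) ^ 2)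
    (hM : 0 < D.M₁) (hRcol : ∀ i j, i ≤ j → j ≤ S.K → D.Rcol j ≤ D.Rcol i) (hρ : 0 ≤ ρ') (hr : 0 ≤ r₀)
    (hRle : ∀ i, i ≤ S.K → (D.Rcol i : ℝ) ≤ ρ' * xlog (S.gk i) ^ r₀)
    (hz0 : ∀ j, j < S.K → 0 ≤ D.zcoef j) (hz : ∀ j, j < S.K → D.zcoef j ≤ A * xlog (S.gk j))
    (hA : 0 ≤ A)
    (hg : ∀ j, j ≤ S.K → 0 < S.gk j ∧ S.gk j ≤ gs) (hgs : gs ≤ 1)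
    (hp : r₀ * 3 + 2 ≤ 2 * D.p₀)
    (hb₁ : 8 * (A * (2 * (2 * ρ' + 2 * ((L : ℝ) * (3 * ((D.M₁ : ℝ) - 1)) + 3 * ((L : ℝ) - 1)) + 20) * 1) ^ 3 /
      (Real.log C.L / 2)) ≤ 1 / (4 * (𝔊.N : ℝ)) * D.b₀ ^ 2)
    (hb₂ : 56 ≤ 1 / (4 * (𝔊.N : ℝ)) * D.b₀ ^ 2) :
    ∀ k, k ≤ D.tower3.toTowerRun.K → ∀ᵐ U ∂(fieldMeasure S.P k G),
      D.tower3.toTowerRun.LF k U (fun h => -(D.tower3.toTowerRun.mainT k h U) + D.tower3.toTowerRun.Zterm k h) ≤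
        Real.exp ((C.d + cm) * D.tower3.toTowerRun.sites k) := by
  classical
  -- the scale profile: `0` at `k = 0` (there `m_0 = 1` must stay `1`), `c_m·|T₁^{(k)}|` above
  let c : ℕ → ℝ := fun k => if k = 0 then 0 else cm * S.sites k
  have hc_le : ∀ k, c k ≤ cm * S.sites k := fun k => by
    by_cases hk : k = 0
    · simp only [c, if_pos hk]; exact mul_nonneg hcm (sites_nonneg S k)
    · simp only [c, if_neg hk]; exact le_rfl
  -- the CAPPED masses `min 1 (e^{−c k}·m_k)` (zero beyond the run): pointwise `≤ 1` with NO hypothesis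
  let W' : HistWeights S.P G :=
    { mass := fun k h U => if k ≤ S.K then min 1 (Real.exp (-(c k)) * D.W.mass k h U) else 0
      mass_nonneg := fun k h U => by
        by_cases hk : k ≤ S.K
        · rw [if_pos hk]; exact le_min zero_le_one (mul_nonneg (Real.exp_pos _).le (D.W.mass_nonneg k h U))
        · rw [if_neg hk]
      mass_le_one := fun k h U => by
        by_cases hk : k ≤ S.K
        · rw [if_pos hk]; exact min_le_left _ _
        · rw [if_neg hk]; exact zero_le_one
      mass_zero := fun h U => by
        show (if 0 ≤ S.K then min 1 (Real.exp (-(c 0)) * D.W.mass 0 h U) else 0) = 1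
        rw [if_pos (Nat.zero_le _)]
        simp only [c, if_true, neg_zero, Real.exp_zero, one_mul, D.W.mass_zero, min_self] }
  -- the std tower input over the SAME averaging, minimisers, regions, coefficients
  let D' : TowerInput S G :=
    { ε₁ := D.ε₁, av := D.av, avgAC := D.avgAC, reg := D.reg, Uk := D.Uk, lower := D.lower, upper := D.upper,
      lower_nonneg := D.lower_nonneg, upper_nonneg := D.upper_nonneg, M₁ := D.M₁, Rcol := D.Rcol, b₀ := D.b₀, p₀ := D.p₀, κ₀ := D.κ₀,
      W := W', UkH := D.UkH, UkH_triv := D.UkH_triv, Pint := D.Pint, zcoef := D.zcoef, rcoef := D.rcoef, Estep := D.Estep }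
  have hW' : ∀ (k : ℕ) (h : Hist S.P k) (U : GaugeField S.P k G), ¬ Hist.Admissible D'.M₁ D'.Rcol k h → D'.W.mass k h U = 0 := by
    intro k h U hh
    show (if k ≤ S.K then min 1 (Real.exp (-(c k)) * D.W.mass k h U) else 0) = 0
    by_cases hk : k ≤ S.K
    · rw [if_pos hk, hW k h U hh, mul_zero]; exact min_eq_right zero_le_one
    · rw [if_neg hk]
  have h' := lf_tower3_avg 𝔊 C hd hCL hL D' hsites hW' hε hC₁ hb₀ hp₀ hrun hγ hLF67 h68 hM hRcol hρ hr hRle hz0 hz hA hg hgs hp hb₁ hb₂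
  intro k hk
  have hkK : k ≤ S.K := hk
  -- the full-measure set where the cap is inactive: `∀ h, m_k(h,U) ≤ e^{c k}` (finitely many histories)
  have hgood : ∀ᵐ U ∂(fieldMeasure S.P k G), ∀ h : Hist S.P k, D.W.mass k h U ≤ Real.exp (c k) := by
    by_cases hk0 : k = 0
    · subst hk0
      refine Filter.Eventually.of_forall fun U h => ?_
      simp only [c, if_true, Real.exp_zero, D.W.mass_zero]
      exact le_rfl
    · have h1 : 1 ≤ k := Nat.one_le_iff_ne_zero.mpr hk0
      have hall := Filter.eventually_all.2 fun h : Hist S.P k => hmass k h1 hkK h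
      filter_upwards [hall] with U hU h
      simp only [c, if_neg hk0]
      exact hU h
  filter_upwards [hgood] with U hU
  -- on that set the functional of the capped input is the scaled functional, at the same exponent
  have hkey : D'.tower3.toTowerRun.LF k U (fun h => -(D'.tower3.toTowerRun.mainT k h U) + D'.tower3.toTowerRun.Zterm k h) =
      Real.exp (-(c k)) * D.tower3.toTowerRun.LF k U (fun h => -(D.tower3.toTowerRun.mainT k h U) + D.tower3.toTowerRun.Zterm k h) := by
    show Carriers.LF W' k U (fun h => -(D.tower3.toTowerRun.mainT k h U) + D.tower3.toTowerRun.Zterm k h) =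
      Real.exp (-(c k)) * LFAC D.W k U (fun h => -(D.tower3.toTowerRun.mainT k h U) + D.tower3.toTowerRun.Zterm k h)
    unfold Carriers.LF LFAC
    rw [Finset.mul_sum]
    refine Finset.sum_congr rfl fun h _ => ?_
    show (if k ≤ S.K then min 1 (Real.exp (-(c k)) * D.W.mass k h U) else 0) * _ = _
    have hcap : Real.exp (-(c k)) * D.W.mass k h U ≤ 1 :=
      calc Real.exp (-(c k)) * D.W.mass k h U ≤ Real.exp (-(c k)) * Real.exp (c k) :=
            mul_le_mul_of_nonneg_left (hU h) (Real.exp_pos _).le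
        _ = 1 := by rw [← Real.exp_add, neg_add_cancel, Real.exp_zero]
    rw [if_pos hkK, min_eq_right hcap, mul_assoc]
  have h1 := h' k hk U
  rw [hkey] at h1
  have hexp : Real.exp (c k) * Real.exp (C.d * D.tower3.toTowerRun.sites k) ≤ Real.exp ((C.d + cm) * D.tower3.toTowerRun.sites k) := by
    rw [← Real.exp_add]
    apply Real.exp_le_exp.mpr
    show c k + C.d * S.sites k ≤ (C.d + cm) * S.sites k
    have := hc_le k
    linarith
  calc D.tower3.toTowerRun.LF k U (fun h => -(D.tower3.toTowerRun.mainT k h U) + D.tower3.toTowerRun.Zterm k h)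
      = Real.exp (c k) * (Real.exp (-(c k)) *
          D.tower3.toTowerRun.LF k U (fun h => -(D.tower3.toTowerRun.mainT k h U) + D.tower3.toTowerRun.Zterm k h)) := by
        rw [← mul_assoc, ← Real.exp_add, add_neg_cancel, Real.exp_zero, one_mul]
    _ ≤ Real.exp (c k) * Real.exp (C.d * D'.tower3.toTowerRun.sites k) := mul_le_mul_of_nonneg_left h1 (Real.exp_pos _).le
    _ ≤ Real.exp ((C.d + cm) * D.tower3.toTowerRun.sites k) := hexp

end Generic

/-! ## §2 Row B25 almost everywhere at the lane's AC tower from the (α)-AC rows and the a.e. mass bound -/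
section Lane

variable {L : ℕ} {S : Scales L} {G : Type} [GaugeGroup G] [MeasurableSpace G] [HaarData G] {𝔊 : GroupModel G} {𝔠 : Primitives.AlphaConsts L 𝔊.N}
  {X : ExternalInputsAC S G} {𝔖 : ∀ k, StepSeries S G ↥(lieC 𝔊) (nblkOf S 𝔠.lane.carrier k) k} {𝔄 : AlphaDataAC 𝔊 𝔠 X 𝔖}
  (hle : S.g ^ 2 * S.ε₀ ≤ (min 𝔠.gamma0 1) ^ 2)
include hle

/-- ★★ **ROW B25, `dU_k`-a.e., AT THE LANE'S AC TOWER `towerOfAC 𝔠.lane X 𝔖` FROM THE (α)-AC ROWS AND THE a.e. MASS BOUND** on the `≤`-family (a.e. twin of file 15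
§2 `lf_towerOfAC_of_alphaAC_of_massBound`; every lane-side hypothesis discharged identically). [cite: Balaban1985UV3, pp.273–274 + (67)–(68) p.273 + (39)–(41) p.266 + (7) p.257] -/
theorem lf_towerOfAC_ae_of_alphaAC_of_massBound_ae (R : RunAlphaAC 𝔊 𝔠 X 𝔖 𝔄) {cm : ℝ} (hcm : 0 ≤ cm)
    (hmass : ∀ k, 1 ≤ k → k ≤ S.K → ∀ h : Hist S.P k, ∀ᵐ U ∂(fieldMeasure S.P k G),
      (inputOfAC 𝔠.lane X 𝔖).W.mass k h U ≤ Real.exp (cm * S.sites k)) :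
    ∀ k, k ≤ (towerOfAC 𝔠.lane X 𝔖).K → ∀ᵐ U ∂(fieldMeasure S.P k G),
      (towerOfAC 𝔠.lane X 𝔖).LF k U (fun h => -((towerOfAC 𝔠.lane X 𝔖).mainT k h U) + (towerOfAC 𝔠.lane X 𝔖).Zterm k h)
        ≤ Real.exp ((𝔠.lane.consts.d + cm) * (towerOfAC 𝔠.lane X 𝔖).sites k) := by
  have hr₀ : 0 ≤ 𝔠.lane.carrier.r₀ := le_trans zero_le_one 𝔠.one_le_r₀
  have hCz : 0 ≤ 𝔠.lane.carrier.Cz + 𝔠.lane.carrier.Cv := add_nonneg 𝔠.Cz_nonneg 𝔠.Cv_nonneg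
  have hc₁ : 0 ≤ 𝔠.lane.carrier.c₁ := by show (0 : ℝ) ≤ 3; norm_num
  have hA : 0 ≤ (𝔠.lane.carrier.Cz + 𝔠.lane.carrier.Cv) + 𝔠.lane.carrier.C₅ + 𝔠.lane.carrier.C₆ +
      (|𝔠.lane.carrier.logσ₀| + 𝔠.lane.carrier.dg) * 𝔠.lane.carrier.c₁ := by
    have := 𝔠.lane.carrier.dg_nonneg
    have := abs_nonneg 𝔠.lane.carrier.logσ₀
    have h5 : 0 ≤ 𝔠.lane.carrier.C₅ := 𝔠.C₅_nonneg
    have h6 : 0 ≤ 𝔠.lane.carrier.C₆ := 𝔠.C₆_nonneg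
    positivity
  have hρ : (0 : ℝ) ≤ (𝔠.lane.carrier.R₁ + 1) * 𝔠.lane.carrier.M₁ := by
    have : 0 ≤ 𝔠.lane.carrier.R₁ := 𝔠.R₁_nonneg
    positivity
  exact lf_towerAC3_ae_of_massBound_ae 𝔊 𝔠.lane.consts (consts3_d_eq_log 𝔠.lane.F 𝔠.lane.sc) rfl S.hL.2 (inputOfAC 𝔠.lane X 𝔖) (gs := 1) (ε := S.g0sq)
    (fun k hk => by exact_mod_cast sites_eq_card S k (by omega))
    (fun k h U hh => StandardAC.stdTowerInputAC_mass_eq_zero_of_not_admissible X 𝔠.lane.carrier 𝔖 k h U hh)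
    hcm hmass (g0sq_pos S) 𝔠.C68_pos 𝔠.lane.F.b₀_pos 𝔠.lane.F.p₀_pos
    (fun j => by rw [show 𝔠.lane.consts.g = 1 from rfl, show 𝔠.lane.consts.L = (L : ℝ) from rfl]; exact gk_eq_gRun_norm S j)
    (fun j hj => (thresholds_of_le hle j hj.le).2.2.2.1) R.hLF67 R.h68 𝔠.lane.F.M₁_pos
    (LargeFieldStd.rcolOf_antitone 𝔠.lane.carrier 𝔠.R₁_nonneg hr₀) hρ hr₀ (LargeFieldStd.rcolOf_le 𝔠.lane.carrier 𝔠.R₁_nonneg hr₀)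
    (LargeFieldStd.zcoefOf_nonneg 𝔠.lane.carrier hCz 𝔠.C₅_nonneg 𝔠.C₆_nonneg hc₁)
    (LargeFieldStd.zcoefOf_le 𝔠.lane.carrier hCz 𝔠.C₅_nonneg 𝔠.C₆_nonneg hc₁) hA
    (fun j hj => ⟨gk_pos S j, gk_le_one S S.gK_le_one j hj⟩) le_rfl 𝔠.prov_r₀p₀ (prov_hb₁ 𝔠 𝔊.N_pos) (prov_hb₂ 𝔠 𝔊.N_pos)

end Lane

/-! ## §3 At print's own averaging pinned to the record (A6 form): the a.e. bound stated on print's iterated Radon–Nikodym masses -/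
section Print

variable {N : ℕ} [NeZero N] {L : ℕ}

variable (N L) in
/-- ★★ **ROW B25, `dU_k`-a.e., AT THE AC TOWERS OVER PRINT'S OWN AVERAGING PINNED TO THE RECORD — A6 ∃X FORM** (file 9 §2's inhabitant `exists_externalInputsAC_ofPrint`:
such inputs EXIST; their masses ARE `MassesAC.massRecAC M₁ Rcol ε_L ε_S (avOfPrint N S)` by `rfl`): for every `SU(N)`, `𝔠`, `εbg`, `c_m ≥ 0` THERE ARE AC external inputs
`X` at print's averaging with the record's minimisers such that, for every expansion data `𝔖` and (α)-AC data `𝔄`, **the (α)-AC rows on a member `S` of the family ∧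
«`massRecAC … (avOfPrint N S) k h ≤ exp(c_m|T₁^{(k)}|)` `dU_k`-a.e., `1 ≤ k ≤ K`» ⇒ B25 holds `dU_k`-a.e. at `towerOfAC 𝔠.lane (X S) (𝔖 S)` with `d + c_m`** — the
a.e. antecedent is exactly what files 16∕17 reduce to a density bound on the least weakly-closed family `ν♯`.
[cite: Balaban1985UV3, pp.273–274 + (41) p.266; Balaban1985Averaging, (15) p.19] -/
theorem lf_towerOfAC_ae_at_print_of_alphaAC_of_massBound_ae (𝔊 : GroupModel (SU N)) (𝔠 : Primitives.AlphaConsts L 𝔊.N) (εbg cm : ℝ) (hcm : 0 ≤ cm) :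
    ∃ X : ∀ S : Scales L, ExternalInputsAC S (SU N), (∀ S, (X S).av = avOfPrint N S) ∧
      (∀ (S : Scales L) k (V : GaugeField S.P (k + 1) (SU N)), (X S).Uk k V = UkA N (fun S => (X S).av) S (k + 1) εbg V) ∧
      ∀ (𝔖 : ∀ (S : Scales L) (k : ℕ), StepSeries S (SU N) ↥(lieC 𝔊) (nblkOf S 𝔠.lane.carrier k) k)
        (𝔄 : ∀ S : Scales L, AlphaDataAC 𝔊 𝔠 (X S) (𝔖 S)) (S : Family L (eps0Of 𝔠.gamma0)),
        RunAlphaAC 𝔊 𝔠 (X S.1) (𝔖 S.1) (𝔄 S.1) →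
        (∀ k, 1 ≤ k → k ≤ S.1.K → ∀ h : Hist S.1.P k, ∀ᵐ U ∂(fieldMeasure S.1.P k (SU N)),
          MassesAC.massRecAC 𝔠.lane.carrier.M₁ (rcolOf S.1 𝔠.lane.carrier) (eps1Of S.1 𝔠.lane.carrier) (epsSOf S.1 𝔠.lane.carrier) (avOfPrint N S.1) k h U ≤
            Real.exp (cm * S.1.sites k)) →
        ∀ k, k ≤ (towerOfAC 𝔠.lane (X S.1) (𝔖 S.1)).K → ∀ᵐ U ∂(fieldMeasure S.1.P k (SU N)),
          (towerOfAC 𝔠.lane (X S.1) (𝔖 S.1)).LF k U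
              (fun h => -((towerOfAC 𝔠.lane (X S.1) (𝔖 S.1)).mainT k h U) + (towerOfAC 𝔠.lane (X S.1) (𝔖 S.1)).Zterm k h)
            ≤ Real.exp ((𝔠.lane.consts.d + cm) * (towerOfAC 𝔠.lane (X S.1) (𝔖 S.1)).sites k) := by
  obtain ⟨X, hav, -, hUk⟩ := exists_externalInputsAC_ofPrint N L εbg
  refine ⟨X, hav, hUk, fun 𝔖 𝔄 S R hmass => lf_towerOfAC_ae_of_alphaAC_of_massBound_ae (le_of_eps0Of S.1 S.2) R hcm fun k hk1 hkK h => ?_⟩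
  have hX : (X S.1).av = avOfPrint N S.1 := hav S.1
  have hm : ∀ U, (inputOfAC 𝔠.lane (X S.1) (𝔖 S.1)).W.mass k h U =
      MassesAC.massRecAC 𝔠.lane.carrier.M₁ (rcolOf S.1 𝔠.lane.carrier) (eps1Of S.1 𝔠.lane.carrier) (epsSOf S.1 𝔠.lane.carrier) (avOfPrint N S.1) k h U := by
    intro U
    rw [show (inputOfAC 𝔠.lane (X S.1) (𝔖 S.1)).W.mass k h U = _ from StandardAC.stdTowerInputAC_mass (X S.1) 𝔠.lane.carrier (𝔖 S.1) k h U, hX]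
  filter_upwards [hmass k hk1 hkK h] with U hU
  rw [hm U]
  exact hU

end Print

end Summit.QuantumFields.YangMills.BalabanUVNodes.N08LargeFieldRowAE

end
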